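import Summits.BirchSwinnertonDyer.BirchSwinnertonDyer.Theorems.KatoDescentPotSupersingularKatoFiniteLevelStrictGoodOutsideP
import HarnessLib

/-!
# Kato's (14.9.3) at finite level, part 21: the `p`-adic factor stabilises — `#E(ℚ_p)[p^k] = #E(ℚ_p)[p^∞] =: p^τ` for `k ≫ 0`
# (Kato (14.10.1): `#H²(ℚ_p, T) = #H⁰(ℚ_p, E[p^∞]) = #E(ℚ_p)[p^∞] = p^τ`), so the bounds of parts 19–20 read
# `… ≤ #Ш(E/ℚ)[p^∞] · ∏_{ℓ} #E(ℚ_ℓ)[p^∞] · p^τ · p^k`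
# (route `KatoDescentPotSupersingular` / `…Tame…`, crux M = stmt-BirchSwinnertonDyer-19196 `ReducibleKatoMember`; route-free helper)

Seat `bsd-potss-rkm` g17 (prover; cell `bsd-potss`), item stmt-BirchSwinnertonDyer-19196 (`--supports … --as helper`; closes
nothing).  HONEST FRAMING: BSD is not proved by any of this; nothing is booked; theorems only (no definition, no named fact).

* **`exists_forall_natCard_ker_nsmul_eq_natCard_primaryComponent`** — at every finite place `v` of a number field there is `a` with
  `E(K_v)[p^k] = E(K_v)[p^∞]` for all `k ≥ a` (one power of `p` kills the rational `p`-primary torsion: Silverman VII.6.3, tree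
  `exists_finiteIndex_torsionFree_adicCompletion`, as in part 14).
* **`natCard_integralH1_quot_le_sha_points_pTorsion`** and **`natCard_integralH1_quot_pow_le_of_good_outside_pTorsion`** — parts 19
  and 20 with the factor `#E(ℚ_p)[p^k]` replaced by the constant `#E(ℚ_p)[p^∞]` (`AddCommGroup.primaryComponent` of Mathlib's
  `(W ⊗ ℚ_p)(ℚ_p)`), i.e. Kato's `p^τ` of (14.10.1): `#(A ⧸ …) ≤ #Ш(E/ℚ)[p^∞] · (∏_{ℓ∈T∖{v_p}} #E(ℚ_ℓ)[p^∞]) · (#E(ℚ_p)[p^∞] · p^k)`.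

References: K. Kato, Astérisque 295 (2004) (14.10.1) (p. 240), Prop. 14.16 (pp. 244–245) [Kato2004Asterisque]; J. H. Silverman,
*AEC* VII.6.3 [SilvermanAEC2009].
-/

-- the summit and its single problem are both named `BirchSwinnertonDyer` (registry layout D-0017)
set_option linter.dupNamespace false
set_option autoImplicit false

noncomputable section

open scoped Classical ContRepresentation NumberField
open Function Field NumberField IsDedekindDomain
open Literature.NumberTheory.EllipticCurves Literature.NumberTheory.GaloisRepresentations
  Literature.NumberTheory.GaloisRepresentations.DiscreteGaloisModule Literature.NumberTheory.GaloisCohomology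
open Literature.NumberTheory.EllipticCurves.Kato2004 Literature.NumberTheory.EllipticCurves.Kato2004.EulerSystemValues
open Summit.BirchSwinnertonDyer.Rank1Residual.X11b.LocBridge

universe u

namespace Summit.BirchSwinnertonDyer.BirchSwinnertonDyer.Theorems.KatoFiniteLevelCount

/-! ## §1 `E(K_v)[p^k] = E(K_v)[p^∞]` for `k ≫ 0` -/

section LocalPTorsion

variable {K : Type u} [Field K] [NumberField K] (W : WeierstrassCurve K) [W.IsElliptic] (p : ℕ) [Fact p.Prime]

/-- **`#E(K_v)[p^k] = #E(K_v)[p^∞]` for all large `k`**: the `p`-primary component of Mathlib's `(W ⊗ K_v)(K_v)` is killed by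
`p^a`, `a = v_p [E(K_v) : U]` for a torsion-free finite-index `U` (Silverman VII.6.3), so for `k ≥ a` the `p^k`-torsion IS the
`p`-primary component. [cite: SilvermanAEC2009, Prop. VII.6.3] -/
theorem exists_forall_natCard_ker_nsmul_eq_natCard_primaryComponent (v : HeightOneSpectrum (𝓞 K)) :
    ∃ a : ℕ, ∀ k, a ≤ k →
      Nat.card (nsmulAddMonoidHom (p ^ k) : (W.baseChange (v.adicCompletion K)).toAffine.Point →+ _).ker =
        Nat.card (AddCommGroup.primaryComponent (W.baseChange (v.adicCompletion K)).toAffine.Point p) := by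
  have hp : p.Prime := Fact.out
  obtain ⟨U, hU, htf, -⟩ := W.exists_finiteIndex_torsionFree_adicCompletion v
  haveI := hU
  obtain ⟨a, u, hu, ht⟩ := Nat.exists_eq_pow_mul_and_not_dvd (AddSubgroup.FiniteIndex.index_ne_zero (H := U)) p hp.ne_one
  have htors : ∀ (P : (W.baseChange (v.adicCompletion K)).toAffine.Point) (m : ℕ), m ≠ 0 → m • P = 0 → U.index • P = 0 :=
    fun P m hm hmP => htf m hm _ (U.nsmul_index_mem P) (by rw [smul_comm, hmP, smul_zero])
  refine ⟨a, fun k hk => Nat.card_congr (Equiv.subtypeEquivRight fun P => ?_)⟩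
  rw [AddMonoidHom.mem_ker, nsmulAddMonoidHom_apply, AddCommGroup.mem_primaryComponent]
  refine ⟨fun h => ⟨k, h⟩, fun ⟨j, hj⟩ => ?_⟩
  have ha : p ^ a • P = 0 := pow_nsmul_eq_zero_of_coprime_mul hp hu (ht ▸ htors P (p ^ j) (pow_ne_zero j hp.ne_zero) hj) hj
  rw [← Nat.sub_add_cancel hk, pow_add, mul_smul, ha, smul_zero]

end LocalPTorsion

/-! ## §2 Parts 19–20 with Kato's `p^τ` -/

section PTorsion

variable (W : WeierstrassCurve ℚ) [W.IsElliptic] (p : ℕ) [Fact p.Prime] [ContinuousSMul ℤ_[p] (W.tateModule p)]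

/-- **Part 19 with `p^τ = #E(ℚ_p)[p^∞]`**: `∃ k₀ ∀ k ≥ k₀`,
`#(A ⧸ (A ∩ p^k H¹(⊤,T_pE))) ≤ #Ш(E/ℚ)[p^∞] · ∏_{ℓ∈T∖{v_p}} #E(ℚ_ℓ)[p^∞] · (#E(ℚ_p)[p^∞] · p^k)`.
[cite: Kato2004Asterisque, (14.10.1) (p. 240) and Prop. 14.16 (pp. 244–245)] -/
theorem natCard_integralH1_quot_le_sha_points_pTorsion (hodd : p ≠ 2) (T : Finset (HeightOneSpectrum (𝓞 ℚ)))
    (hpT : primePlace p ∈ T) (hT : ∀ v : HeightOneSpectrum (𝓞 ℚ), v ∉ T → W.HasGoodReductionAt v)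
    (hI : ∀ v ∈ T \ {primePlace p}, Set.Finite {x : W.geomPrimaryTorsion p |
      ∀ τ ∈ absInertia (v.adicCompletion ℚ), GaloisRep.toLocal v (primaryGaloisModule W p) τ x = x})
    [Finite W.toAffine.Point] [Finite (AddCommGroup.primaryComponent W.sha p)]
    (hSC : ∀ k : ℕ, (LocalInvariants.canonical ℚ (p ^ k)).SelmerComplement) :
    ∃ k₀ : ℕ, ∀ k, k₀ ≤ k →
      Nat.card (integralH1 (tateRep W p) p ⊤ ⧸
          AddSubgroup.comap (integralH1 (tateRep W p) p ⊤).toAddSubgroup.subtype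
            (LinearMap.range (DistribSMul.toLinearMap ℤ_[p] (H1 (tateRep W p) ⊤)
              ((p : ℤ_[p]) ^ k))).toAddSubgroup) ≤
        Nat.card (AddCommGroup.primaryComponent W.sha p) *
          (∏ v ∈ T \ {primePlace p},
            Nat.card (AddCommGroup.primaryComponent (W.baseChange (v.adicCompletion ℚ)).toAffine.Point p)) *
          (Nat.card (AddCommGroup.primaryComponent (W.baseChange ((primePlace p).adicCompletion ℚ)).toAffine.Point p) *
            p ^ k) := by
  obtain ⟨k₀, hk₀⟩ := natCard_integralH1_quot_le_sha_points W p hodd T hpT hT hI hSC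
  obtain ⟨a, ha⟩ := exists_forall_natCard_ker_nsmul_eq_natCard_primaryComponent W p (primePlace p)
  refine ⟨max k₀ a, fun k hk => ?_⟩
  rw [← ha k (le_of_max_le_right hk)]
  exact hk₀ k (le_of_max_le_left hk)

/-- **Part 20 with `p^τ = #E(ℚ_p)[p^∞]`** (good reduction outside `p`): `∃ k₀ ∀ k ≥ k₀`,
`#(A ⧸ p^k A) ≤ #Ш(E/ℚ)[p^∞] · (#E(ℚ_p)[p^∞] · p^k)`, `A = H¹(ℤ[1/p], T_pE)`.
[cite: Kato2004Asterisque, (14.10.1) (p. 240) and Prop. 14.16 (pp. 244–245)] -/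
theorem natCard_integralH1_quot_pow_le_of_good_outside_pTorsion (hodd : p ≠ 2)
    (hgood : ∀ v : HeightOneSpectrum (𝓞 ℚ), v ≠ primePlace p → W.HasGoodReductionAt v)
    [Finite W.toAffine.Point] [Finite (AddCommGroup.primaryComponent W.sha p)]
    (hSC : ∀ k : ℕ, (LocalInvariants.canonical ℚ (p ^ k)).SelmerComplement) :
    ∃ k₀ : ℕ, ∀ k, k₀ ≤ k →
      Nat.card (integralH1 (tateRep W p) p ⊤ ⧸
          (LinearMap.range (DistribSMul.toLinearMap ℤ_[p] (integralH1 (tateRep W p) p ⊤)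
            ((p : ℤ_[p]) ^ k))).toAddSubgroup) ≤
        Nat.card (AddCommGroup.primaryComponent W.sha p) *
          (Nat.card (AddCommGroup.primaryComponent (W.baseChange ((primePlace p).adicCompletion ℚ)).toAffine.Point p) *
            p ^ k) := by
  obtain ⟨k₀, hk₀⟩ := natCard_integralH1_quot_pow_le_of_good_outside W p hodd hgood hSC
  obtain ⟨a, ha⟩ := exists_forall_natCard_ker_nsmul_eq_natCard_primaryComponent W p (primePlace p)
  refine ⟨max k₀ a, fun k hk => ?_⟩
  rw [← ha k (le_of_max_le_right hk)]
  exact hk₀ k (le_of_max_le_left hk)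

end PTorsion

end Summit.BirchSwinnertonDyer.BirchSwinnertonDyer.Theorems.KatoFiniteLevelCount

end
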